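import Literature.NumberTheory.GaloisRepresentations.TateLevelOneHasseBridge
import Literature.NumberTheory.GaloisRepresentations.TateLevelOneRatTwo
import Literature.NumberTheory.GaloisRepresentations.TateLevelOneIndexTwo
import Literature.NumberTheory.GaloisRepresentations.WildInertia
import Literature.NumberTheory.GaloisRepresentations.UnramifiedKummer
import Literature.NumberTheory.GaloisRepresentations.LocalWeilDatumUnramified
import Literature.NumberTheory.GaloisRepresentations.LocalGaloisGroupFrobeniusProofs
import Literature.NumberTheory.QuadraticForms.HilbertSymbolRatOdd
import Mathlib.Algebra.CharP.Two
import Mathlib.NumberTheory.SumTwoSquares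
import HarnessLib

/-!
# Tate's theorem `H²(G_ℚ, ℚ/ℤ) = 0` at level one, IX: the prime `2`
# (Serre, Durham 1977, §6.5, `p = 2`; descent through `ℚ(i)`)

Sibling proof file (theorems only) of `TateProjectiveLifting.lean`.  For `p = 2` the level-one
argument over `ℚ` (`rat_exists_character_levelOne_two`) leaves the real place uncontrolled; the
missing global input is supplied by the Hasse principle for `Br(ℚ(i))`
(`brauerHassePrinciple (CyclotomicField 4 ℚ)`, all places of `ℚ(i)` being complex) followed by an
explicit analysis of the kernel of `H²(Γ_ℚ, ℤ/2) → H²(Γ_{ℚ(i)}, ℤ/2)`: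

* `localField_cup_not_split` — **at an odd place, `χ ∪ w` is not a level-one coboundary when `χ`
  is unramified with `χ(Frob) ≠ 0` and `w` is ramified** (tame structure: `Frob σ Frob⁻¹ ≡ σ^q`
  modulo the pro-`q` wild inertia, Serre, *Corps locaux* IV §2);
* `twoCocycle_indexTwo_cup_norm_split` — **`χ_{-1} ∪ χ_{N(θ)} = ∂γ` explicitly** for `θ ∈ ℚ(i)ˣ`
  (`γ(x) = χ_θ(x)` or `χ_θ(xc)`; the projection formula `χ ∪ cor = cor(res χ ∪ ·) = 0`);
* `twoCocycle_addCircle_two_split_rat_of_brauerHassePrinciple` — **`(H_2)(Γ_ℚ)`**: a locally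
  constant `2`-torsion `2`-cocycle `g` on `Γ_ℚ` is the coboundary of a locally constant cochain,
  granted `brauerHassePrinciple (ℚ(i))`: `z = g - ∂c` is finite-locally trivial
  (`rat_exists_character_levelOne_two`), hence splits on `Γ_{ℚ(i)}` (`hasseInput_of_brauerHassePrinciple`),
  hence `z ∼ χ_{-1} ∪ w` (`twoCocycle_indexTwo_eq_cup_add_coboundary`); `w = χ_a` by Hilbert 90,
  `a ∈ ℤ`; local triviality at the primes `q ≡ 3 (4)` forces `v_q(a)` even
  (`localField_cup_not_split` with Kummer theory on inertia), so `|a| = x² + y²` (Fermat,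
  `Nat.eq_sq_add_sq_iff`) and `χ_{-1} ∪ χ_{|a|} = ∂γ`; if `a < 0` the remaining `χ_{-1} ∪ χ_{-1}`
  would be locally trivial at `2`, contradicting `adicCompletion_rat_not_two_divisible`; so
  `z = ∂(γ + δ)`;
* `Tate_projectiveLifting_of_brauerHassePrinciple'` — **`Tate_projectiveLifting` from the Hasse
  principle for `Br(ℚ(μ_p))` (`p` odd) and `Br(ℚ(i))`.**

## References

* J.-P. Serre, *Modular forms of weight one and Galois representations* (Durham 1977), §6.5.
  [SerreDurham1977]
* J.-P. Serre, *Local Fields* (1979), Ch. IV §2, Ch. XIV. [SerreLocalFields1979]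
* D. Harari, *Galois Cohomology and Class Field Theory* (2020), Thm. 14.11. [Harari2020]
-/

noncomputable section

open Field ValuativeRel IsDedekindDomain NumberField
open scoped Pointwise NumberField

namespace Literature.NumberTheory.GaloisRepresentations

open Literature.NumberTheory.GaloisCohomology GaloisRepresentations.IsNonarchimedeanLocalField

/-! ### An odd local place: `χ ∪ w` does not split when `χ` is unramified non-trivial and `w` ramified -/

section LocalOdd

variable (F : Type*) [Field F] [ValuativeRel F] [TopologicalSpace F] [IsNonarchimedeanLocalField F]

/-- **At a place of odd residue characteristic, the cup product of an unramified character
non-trivial on Frobenius with a ramified character is not a level-one coboundary.**  Let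
`X, W : Γ_F → ℤ/2` be additive, `X` trivial on the inertia group and `1` on (every) arithmetic
Frobenius, `W` locally constant and non-trivial on inertia; then there is no locally constant
`B : Γ_F → ℤ/2` with `B(xy) = B(x) + B(y) + X(x) W(y)`.  (With `σ₀ ∈ I`, `W(σ₀) = 1`, and
`φ σ₀ φ⁻¹ = ω σ₀^q`, `ω` in the pro-`p` wild inertia on which `B` and `W` vanish, one computes
`B(φσ₀φ⁻¹) = B(σ₀) + 1` and `B(ω σ₀^q) = B(σ₀)`.)  Serre, *Corps locaux* IV §2 (tame inertia),
XIV §3 (the symbol `(a, b)` at a tame place). [cite: SerreLocalFields1979, Ch. IV §2 and Ch. XIV §3] -/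
theorem localField_cup_not_split (hodd : Odd (ringChar 𝓀[F]))
    (X W B : absoluteGaloisGroup F → ZMod 2)
    (hX : ∀ x y, X (x * y) = X x + X y) (hW : ∀ x y, W (x * y) = W x + W y)
    (hXI : ∀ σ ∈ absInertia F, X σ = 0) (hXφ : ∀ τ, IsAbsArithFrob τ → X τ = 1)
    (hWI : ∃ σ₀ ∈ absInertia F, W σ₀ = 1) (hW_lc : IsLocallyConstant W)
    (hB_lc : IsLocallyConstant B) (hB : ∀ x y, B (x * y) = B x + B y + X x * W y) : False := by
  classical
  haveI : CompactSpace (absoluteGaloisGroup F) := absoluteGaloisGroup_compactSpace F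
  have hA : ∀ a : ZMod 2, a + a = 0 := CharTwo.add_self_eq_zero
  obtain ⟨σ₀, hσ₀I, hWσ₀⟩ := hWI
  obtain ⟨φ, hφ⟩ := (exists_isAbsArithFrob_holds (F := F))
  have hφ1 : IsFrobPow φ ((1 : ℕ) : ℤ) := IsAbsArithFrob.isFrobPow_holds hφ
  obtain ⟨ϖ, hϖ⟩ := IsDiscreteValuationRing.exists_irreducible 𝒪[F]
  -- odd residue cardinality
  have hq_odd : Odd (residueFieldCard F) := by
    obtain ⟨f, -, hf⟩ := residueFieldCard_eq_pow_ringChar F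
    rw [hf]
    exact hodd.pow
  -- elementary identities
  have hX1 : X 1 = 0 := character_apply_one hX
  have hW1 : W 1 = 0 := character_apply_one hW
  have hB1 : B 1 = 0 := by
    have h := hB 1 1
    rw [mul_one, hX1, zero_mul, add_zero] at h
    exact h.trans (hA _)
  have hBI : ∀ x ∈ absInertia F, ∀ n : ℕ, B (x ^ n) = n • B x := fun x hx n => by
    induction n with
    | zero => rw [pow_zero, hB1, zero_smul]
    | succ n ih =>
        rw [pow_succ, hB, ih, character_apply_pow hX, hXI x hx, smul_zero, zero_mul, add_zero,
          succ_nsmul]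
  have hodd_smul : ∀ {n : ℕ}, Odd n → ∀ b : ZMod 2, n • b = b := fun hn b => by
    rw [nsmul_eq_mul, ZMod.natCast_eq_one_iff_odd.mpr hn, one_mul]
  -- `B` and `W` vanish on the (pro-`p`) wild inertia group
  obtain ⟨UW, hUW⟩ := exists_openNormalSubgroup_forall_mul_eq_of_isLocallyConstant hW_lc
  obtain ⟨UB, hUB⟩ := exists_openNormalSubgroup_forall_mul_eq_of_isLocallyConstant hB_lc
  have hP : ∀ x ∈ absWildInertia F ϖ, W x = 0 ∧ B x = 0 := fun x hx => by
    have hxI : x ∈ absInertia F := absWildInertia_le_absInertia F ϖ hx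
    obtain ⟨a, ha⟩ := absWildInertia_isProP_holds (F := F) hϖ hx
      ((UW : Subgroup _) ⊓ (UB : Subgroup _)) ((UW.isOpen).inter UB.isOpen)
    have hpa : Odd (ringChar 𝓀[F] ^ a) := hodd.pow
    constructor
    · have h1 : W (1 * x ^ ringChar 𝓀[F] ^ a) = W 1 := hUW 1 _ ha.1
      rw [one_mul, character_apply_pow hW, hW1, hodd_smul hpa] at h1
      exact h1
    · have h1 : B (1 * x ^ ringChar 𝓀[F] ^ a) = B 1 := hUB 1 _ ha.2
      rw [one_mul, hBI x hxI, hB1, hodd_smul hpa] at h1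
      exact h1
  -- the tame relation `φ σ₀ φ⁻¹ = ω σ₀^q`
  set ω := φ * σ₀ * φ⁻¹ * (σ₀ ^ residueFieldCard F ^ 1)⁻¹ with hω_def
  have hω : ω ∈ absWildInertia F ϖ := conj_mul_pow_inv_mem_absWildInertia hϖ.ne_zero hφ1 hσ₀I
  have hωI : ω ∈ absInertia F := absWildInertia_le_absInertia F ϖ hω
  have e1 : φ * σ₀ * φ⁻¹ = ω * σ₀ ^ residueFieldCard F := by
    rw [hω_def, pow_one, inv_mul_cancel_right]
  -- `B(ω σ₀^q) = B(σ₀)`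
  have hR : B (ω * σ₀ ^ residueFieldCard F) = B σ₀ := by
    rw [hB, (hP ω hω).2, hXI ω hωI, zero_mul, zero_add, add_zero, hBI σ₀ hσ₀I, hodd_smul hq_odd]
  -- `B(φ σ₀ φ⁻¹) = B(σ₀) + 1`
  have hXφ1 : X φ = 1 := hXφ φ hφ
  have h4 : B φ⁻¹ = B φ + W φ⁻¹ := by
    have h := hB φ φ⁻¹
    rw [mul_inv_cancel, hB1, hXφ1, one_mul] at h
    -- `h : 0 = B φ + B φ⁻¹ + W φ⁻¹`
    calc B φ⁻¹ = B φ⁻¹ + (B φ + B φ⁻¹ + W φ⁻¹) := by rw [← h, add_zero]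
      _ = (B φ⁻¹ + B φ⁻¹) + (B φ + W φ⁻¹) := by abel
      _ = B φ + W φ⁻¹ := by rw [hA, zero_add]
  have hL : B (φ * σ₀ * φ⁻¹) = B σ₀ + 1 := by
    rw [hB, hB φ σ₀, hX, hXφ1, hXI σ₀ hσ₀I, hWσ₀, h4, add_zero, one_mul, one_mul]
    calc B φ + B σ₀ + 1 + (B φ + W φ⁻¹) + W φ⁻¹
        = B σ₀ + 1 + (B φ + B φ) + (W φ⁻¹ + W φ⁻¹) := by abel
      _ = B σ₀ + 1 := by rw [hA, hA, add_zero, add_zero]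
  rw [e1, hR] at hL
  have h10 : (1 : ZMod 2) = 0 := by
    calc (1 : ZMod 2) = B σ₀ + 1 + B σ₀ := by rw [add_comm (B σ₀) 1, add_assoc, hA, add_zero]
      _ = B σ₀ + B σ₀ := by rw [← hL]
      _ = 0 := hA _
  exact one_ne_zero h10

end LocalOdd

/-! ### Index two: the character `χ_S` and the explicit splitting of `χ_S ∪ χ_{N θ}` -/

section NormSplit

variable {G : Type*} [Group G]

/-- For a subgroup `S` of index `2` (`G = S ∪ Sc`, `c² = 1`, `cSc ⊆ S`), the indicator of `G ∖ S`
with values in `ℤ/2` is an additive character `χ_S`. [folklore] -/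
theorem indexTwo_indicator_mul (S : Subgroup G) [DecidablePred (· ∈ S)] (c : G) (hcc : c * c = 1)
    (hSc : ∀ x, x ∉ S → x * c ∈ S) (hnorm : ∀ h ∈ S, c * h * c ∈ S) (x y : G) :
    (if x * y ∈ S then (0 : ZMod 2) else 1) =
      (if x ∈ S then (0 : ZMod 2) else 1) + (if y ∈ S then (0 : ZMod 2) else 1) := by
  by_cases hx : x ∈ S <;> by_cases hy : y ∈ S
  · rw [if_pos (S.mul_mem hx hy), if_pos hx, if_pos hy, add_zero]
  · have hxy : x * y ∉ S := fun h => hy (by simpa using S.mul_mem (S.inv_mem hx) h)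
    rw [if_neg hxy, if_pos hx, if_neg hy, zero_add]
  · have hxy : x * y ∉ S := fun h => hx (by simpa using S.mul_mem h (S.inv_mem hy))
    rw [if_neg hxy, if_neg hx, if_pos hy, add_zero]
  · have hxy : x * y ∈ S := by
      have e : x * y = (x * c) * (c * (y * c) * c) := by
        simp only [mul_assoc, hcc, mul_one]
        rw [← mul_assoc c c, hcc, one_mul]
      rw [e]
      exact S.mul_mem (hSc x hx) (hnorm _ (hSc y hy))
    rw [if_pos hxy, if_neg hx, if_neg hy, CharTwo.add_self_eq_zero]

/-- **`χ_S ∪ χ_n = ∂γ` explicitly when `n` is a norm from the quadratic subfield** (the case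
`χ_{-1} ∪ χ_{x² + y²} = 0` of Serre, Durham §6.5 / *Cours d'arithmétique* III §1: `(a, b) = 1`
iff `b` is a norm from `k(√a)`), cochain level with trivial `ℤ/2`-coefficients.  Let `S ≤ G` be of
index `2` as above, `χθ : G → ℤ/2` additive on `S` (the Kummer character of `√θ` on `Γ_{ℚ(i)}`),
`χn` an additive character of `G` with `χn(k) = χθ(k) + χθ(ckc)` on `S` and `χn(c) = 0` (the
Kummer character of `√(θ θ̄)`).  Then with `γ(z) = χθ(z)` for `z ∈ S` and `γ(z) = χθ(zc)`
otherwise, `χ_S(x) χn(y) = γ(x) + γ(y) + γ(xy)`. [cite: SerreDurham1977, §6.5] -/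
theorem indexTwo_cup_eq_coboundary_of_norm (S : Subgroup G) [DecidablePred (· ∈ S)] (c : G)
    (hcc : c * c = 1) (hSc : ∀ x, x ∉ S → x * c ∈ S) (hnorm : ∀ h ∈ S, c * h * c ∈ S)
    (χθ χn : G → ZMod 2) (hθS : ∀ h ∈ S, ∀ k ∈ S, χθ (h * k) = χθ h + χθ k)
    (hn_add : ∀ x y, χn (x * y) = χn x + χn y) (hn3 : ∀ k ∈ S, χn k = χθ k + χθ (c * k * c))
    (hn4 : χn c = 0) (x y : G) :
    (if x ∈ S then (0 : ZMod 2) else 1) * χn y =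
      χθ (if x ∈ S then x else x * c) + χθ (if y ∈ S then y else y * c) +
        χθ (if x * y ∈ S then x * y else x * y * c) := by
  have hA : ∀ a : ZMod 2, a + a = 0 := CharTwo.add_self_eq_zero
  by_cases hx : x ∈ S <;> by_cases hy : y ∈ S
  · rw [if_pos hx, if_pos hx, if_pos hy, if_pos (S.mul_mem hx hy), zero_mul, hθS x hx y hy]
    calc (0 : ZMod 2) = (χθ x + χθ y) + (χθ x + χθ y) := (hA _).symm
      _ = _ := by abel
  · have hxy : x * y ∉ S := fun h => hy (by simpa using S.mul_mem (S.inv_mem hx) h)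
    have hk : y * c ∈ S := hSc y hy
    rw [if_pos hx, if_pos hx, if_neg hy, if_neg hxy, zero_mul, mul_assoc, hθS x hx _ hk]
    calc (0 : ZMod 2) = (χθ x + χθ (y * c)) + (χθ x + χθ (y * c)) := (hA _).symm
      _ = _ := by abel
  · have hxy : x * y ∉ S := fun h => hx (by simpa using S.mul_mem h (S.inv_mem hy))
    have hh : x * c ∈ S := hSc x hx
    have e : x * y * c = (x * c) * (c * y * c) := by
      simp only [mul_assoc]
      rw [← mul_assoc c c, hcc, one_mul]
    rw [if_neg hx, if_neg hx, if_pos hy, if_neg hxy, one_mul, e, hθS _ hh _ (hnorm y hy),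
      hn3 y hy]
    calc χθ y + χθ (c * y * c)
        = χθ y + χθ (c * y * c) + (χθ (x * c) + χθ (x * c)) := by rw [hA, add_zero]
      _ = _ := by abel
  · have hh : x * c ∈ S := hSc x hx
    have hk : y * c ∈ S := hSc y hy
    have e : x * y = (x * c) * (c * (y * c) * c) := by
      simp only [mul_assoc, hcc, mul_one]
      rw [← mul_assoc c c, hcc, one_mul]
    have hxy : x * y ∈ S := by
      rw [e]
      exact S.mul_mem hh (hnorm _ hk)
    have hny : χn y = χn (y * c) := by rw [hn_add, hn4, add_zero]
    rw [if_neg hx, if_neg hx, if_neg hy, if_pos hxy, one_mul, hny, hn3 _ hk]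
    conv_rhs => rw [e, hθS _ hh _ (hnorm _ hk)]
    calc χθ (y * c) + χθ (c * (y * c) * c)
        = χθ (y * c) + χθ (c * (y * c) * c) + (χθ (x * c) + χθ (x * c)) := by rw [hA, add_zero]
      _ = _ := by abel

end NormSplit

/-! ### Kummer theory for quadratic characters (via Hilbert 90) -/

section Kummer

variable (K : Type*) [Field K] [CharZero K]

/-- **A locally constant quadratic character of `Γ_K` is the Kummer character of a square root**
(`char K = 0`): for `w : Γ_K → ℤ/2` additive and locally constant there is `α ∈ K̄ˣ` with
`α² ∈ K`, `σ α = ±α` and `w(σ) = 0 ↔ σ α = α`.  Proof: `σ ↦ (-1)^{w(σ)}` is a `1`-cocycle,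
`= σ(α)/α` by Hilbert 90 (`exists_eq_smul_div_of_isLocallyConstant_cocycle`), and `α²` is
`Γ_K`-invariant, hence in `K`. [cite: SerreLocalFields1979, Ch. X §1 Prop. 2 and §3] -/
theorem exists_kummer_generator_of_quadratic_character
    (w : absoluteGaloisGroup K → ZMod 2) (hw : ∀ x y, w (x * y) = w x + w y)
    (hw_lc : IsLocallyConstant w) :
    ∃ (α : AlgebraicClosure K) (a : K), α ≠ 0 ∧ algebraMap K (AlgebraicClosure K) a = α ^ 2 ∧
      (∀ σ : absoluteGaloisGroup K, σ • α = α ∨ σ • α = -α) ∧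
      ∀ σ : absoluteGaloisGroup K, w σ = 0 ↔ σ • α = α := by
  classical
  -- the cocycle `f = (-1)^w`
  set f : absoluteGaloisGroup K → AlgebraicClosure K := fun σ => if w σ = 0 then 1 else -1
    with hf_def
  have hf_lc : IsLocallyConstant f := hw_lc.comp fun t => if t = 0 then (1 : AlgebraicClosure K) else -1
  have hf0 : ∀ σ, f σ ≠ 0 := fun σ => by
    simp only [hf_def]
    split_ifs
    · exact one_ne_zero
    · exact neg_ne_zero.mpr one_ne_zero
  have hfix : ∀ (σ : absoluteGaloisGroup K) (τ : absoluteGaloisGroup K), σ • f τ = f τ := fun σ τ => by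
    simp only [hf_def]
    split_ifs
    · exact smul_one σ
    · rw [smul_neg, smul_one]
  have h01 : ∀ t : ZMod 2, t = 0 ∨ t = 1 := by decide
  have h10 : (1 : ZMod 2) ≠ 0 := by decide
  have h11 : (1 : ZMod 2) + 1 = 0 := by decide
  have hcoc : ∀ σ τ, f (σ * τ) = f σ * σ • f τ := fun σ τ => by
    rw [hfix]
    rcases h01 (w σ) with h0 | h1 <;> rcases h01 (w τ) with k0 | k1
    · simp [hf_def, hw, h0, k0]
    · simp [hf_def, hw, h0, k1, h10]
    · simp [hf_def, hw, h1, k0, h10]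
    · simp [hf_def, hw, h1, k1, h10, h11]
  obtain ⟨α, hα0, hα⟩ :=
    absoluteGaloisGroup.exists_eq_smul_div_of_isLocallyConstant_cocycle K hf_lc hf0 hcoc
  -- `σ α = f σ α = ± α`
  have hσα : ∀ σ : absoluteGaloisGroup K, σ • α = f σ * α := fun σ => by
    rw [hα σ, div_mul_cancel₀ _ hα0]
  have hpm : ∀ σ : absoluteGaloisGroup K, σ • α = α ∨ σ • α = -α := fun σ => by
    rw [hσα]
    simp only [hf_def]
    split_ifs
    · exact Or.inl (one_mul α)
    · exact Or.inr (neg_one_mul α)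
  -- `α²` is invariant, hence in `K`
  have hinv : ∀ σ : absoluteGaloisGroup K, σ • α ^ 2 = α ^ 2 := fun σ => by
    rw [smul_pow']
    rcases hpm σ with h | h <;> rw [h]
    rw [neg_sq]
  haveI : ExpChar K 1 := ExpChar.zero
  obtain ⟨m, a, ha⟩ := absoluteGaloisGroup.exists_algebraMap_eq_pow_of_forall_smul_eq K 1 hinv
  rw [one_pow, pow_one] at ha
  refine ⟨α, a, hα0, ha, hpm, fun σ => ?_⟩
  have hne : α ≠ -α := fun h => hα0 (by
    have h2 : α + α = 0 := by nth_rewrite 2 [h]; exact add_neg_cancel α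
    rwa [← two_mul, mul_eq_zero, or_iff_right (two_ne_zero)] at h2)
  constructor
  · intro h0
    rw [hσα, hf_def]
    simp only [h0, if_true, one_mul]
  · intro h
    by_contra h0
    rw [hσα, hf_def] at h
    simp only [h0, if_false, neg_one_mul] at h
    exact hne h.symm

end Kummer

/-! ### Ramification and Frobenius at an odd place of `ℚ` -/

section RatOddPlace

open Literature.NumberTheory.QuadraticForms Rat.HeightOneSpectrum

variable (v : HeightOneSpectrum (𝓞 ℚ))

/-- For `γ : ℤᵐ⁰`, `γ < 1` implies `γ ≤ exp (-1)`. [folklore] -/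
theorem withZero_le_exp_neg_one_of_lt_one {γ : WithZero (Multiplicative ℤ)} (h : γ < 1) : γ ≤ WithZero.exp (-1 : ℤ) := by
  rcases eq_or_ne γ 0 with rfl | h0
  · simp
  · rw [← WithZero.exp_log h0] at h ⊢
    rw [← WithZero.exp_zero, WithZero.exp_lt_exp] at h
    rw [WithZero.exp_le_exp]
    omega

/-- The valuation of `q m` (`q` the prime under `v`, `q ∤ m`) in `ℚ_v` is `exp (-1)`. [folklore] -/
theorem valued_adicCompletion_rat_prime_mul {q : ℕ} (hv : (primesEquiv v : ℕ) = q) {m : ℤ}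
    (hm : ¬ (q : ℤ) ∣ m) :
    Valued.v (algebraMap ℚ (v.adicCompletion ℚ) (((q : ℤ) * m : ℤ) : ℚ)) = WithZero.exp (-1 : ℤ) := by
  have hq : natGenerator v = q := hv
  have h1 : Valued.v (algebraMap ℚ (v.adicCompletion ℚ) (((q : ℤ) * m : ℤ) : ℚ)) =
      v.valuation ℚ (((q : ℤ) * m : ℤ) : ℚ) :=
    HeightOneSpectrum.valuedAdicCompletion_eq_valuation' v _
  rw [h1, Int.cast_mul, map_mul, Int.cast_natCast,
    show ((q : ℚ)) = algebraMap (𝓞 ℚ) ℚ ((q : ℕ) : 𝓞 ℚ) from (map_natCast _ q).symm,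
    show ((m : ℚ)) = algebraMap (𝓞 ℚ) ℚ ((m : ℤ) : 𝓞 ℚ) from (map_intCast _ m).symm,
    HeightOneSpectrum.valuation_of_algebraMap, HeightOneSpectrum.valuation_of_algebraMap, ← hq,
    RatPlace.intValuation_natGenerator,
    HeightOneSpectrum.intValuation_eq_one_iff.mpr ((RatPlace.intCast_mem_asIdeal_iff v m).not.mpr
      (hq ▸ hm)), mul_one]

/-- An element of `ℚ_v` of valuation `exp (-1)` is a uniformiser: it lies in the valuation ring
and is irreducible there. [folklore] -/
theorem adicCompletion_rat_irreducible_of_valued_eq {x : v.adicCompletion ℚ}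
    (hx : Valued.v x = WithZero.exp (-1 : ℤ)) :
    ∃ hmem : x ∈ 𝒪[v.adicCompletion ℚ], Irreducible (⟨x, hmem⟩ : 𝒪[v.adicCompletion ℚ]) := by
  -- comparison of the two compatible valuations
  have hle : ∀ a b : v.adicCompletion ℚ,
      valuation (v.adicCompletion ℚ) a ≤ valuation (v.adicCompletion ℚ) b ↔ Valued.v a ≤ Valued.v b :=
    fun a b => (Valuation.Compatible.vle_iff_le (v := valuation (v.adicCompletion ℚ)) a b).symm.trans
      (Valuation.Compatible.vle_iff_le (v := (Valued.v : Valuation (v.adicCompletion ℚ) (WithZero (Multiplicative ℤ)))) a b)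
  have hlt : ∀ a b : v.adicCompletion ℚ,
      valuation (v.adicCompletion ℚ) a < valuation (v.adicCompletion ℚ) b ↔ Valued.v a < Valued.v b :=
    fun a b => by rw [← not_le, ← not_le, hle]
  have hx1 : Valued.v x < 1 := by
    rw [hx, ← WithZero.exp_zero, WithZero.exp_lt_exp]; decide
  have hx0 : Valued.v x ≠ 0 := by rw [hx]; exact WithZero.exp_ne_zero
  have hmem : x ∈ 𝒪[v.adicCompletion ℚ] := by
    change valuation (v.adicCompletion ℚ) x ≤ 1
    rw [← (valuation (v.adicCompletion ℚ)).map_one, hle, Valuation.map_one]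
    exact hx1.le
  refine ⟨hmem, ?_, fun a b hab => ?_⟩
  · rw [Valuation.Integer.not_isUnit_iff_valuation_lt_one]
    show valuation (v.adicCompletion ℚ) x < 1
    rw [← (valuation (v.adicCompletion ℚ)).map_one, hlt, Valuation.map_one]
    exact hx1
  · by_contra h
    rw [not_or, Valuation.Integer.not_isUnit_iff_valuation_lt_one,
      Valuation.Integer.not_isUnit_iff_valuation_lt_one] at h
    have ha : Valued.v (a : v.adicCompletion ℚ) < 1 := by
      have := h.1; rwa [← (valuation (v.adicCompletion ℚ)).map_one, hlt, Valuation.map_one] at this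
    have hb : Valued.v (b : v.adicCompletion ℚ) < 1 := by
      have := h.2; rwa [← (valuation (v.adicCompletion ℚ)).map_one, hlt, Valuation.map_one] at this
    have ha' := withZero_le_exp_neg_one_of_lt_one ha
    have hb' := withZero_le_exp_neg_one_of_lt_one hb
    have hxab : Valued.v x = Valued.v (a : v.adicCompletion ℚ) * Valued.v (b : v.adicCompletion ℚ) := by
      rw [← map_mul]
      exact congrArg _ (congrArg Subtype.val hab)
    have : WithZero.exp (-1 : ℤ) ≤ WithZero.exp (-1 : ℤ) * WithZero.exp (-1 : ℤ) := by
      calc WithZero.exp (-1 : ℤ) = Valued.v x := hx.symm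
        _ = _ := hxab
        _ ≤ WithZero.exp (-1 : ℤ) * WithZero.exp (-1 : ℤ) := mul_le_mul' ha' hb'
    rw [← WithZero.exp_add, WithZero.exp_le_exp] at this
    omega

/-- **Kummer theory on inertia at an odd place**: if `a = q^{2k+1} m` with `q ∤ m` (`q` the prime
under `v`) and `α² = a` in `ℚ̄`, some element of the inertia group of `ℚ_v` sends (the image in
`\bar{ℚ_v}` of) `α` to `-α` (`α / q^k` is a square root of the uniformiser `q m`;
`exists_mem_absInertia_smul_eq_mul`). [cite: SerreInventiones1972, §1.3] -/
theorem adicCompletion_rat_exists_mem_absInertia_smul_eq_neg {q : ℕ} (hq : q.Prime)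
    (hv : (primesEquiv v : ℕ) = q) {a m : ℤ} {k : ℕ} (ha : a = (q : ℤ) ^ (2 * k + 1) * m)
    (hm : ¬ (q : ℤ) ∣ m) (α : AlgebraicClosure ℚ)
    (hα : algebraMap ℚ (AlgebraicClosure ℚ) (a : ℚ) = α ^ 2) :
    ∃ σ ∈ absInertia (v.adicCompletion ℚ),
      σ • absClosureEmbedding ℚ (v.adicCompletion ℚ) α = -absClosureEmbedding ℚ (v.adicCompletion ℚ) α := by
  set F := v.adicCompletion ℚ
  set ι := absClosureEmbedding ℚ (v.adicCompletion ℚ) with hι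
  -- the uniformiser `ϖ = q m`
  obtain ⟨hmem, hϖ⟩ := adicCompletion_rat_irreducible_of_valued_eq v
    (valued_adicCompletion_rat_prime_mul v hv hm)
  set ϖ : 𝒪[v.adicCompletion ℚ] :=
    ⟨algebraMap ℚ (v.adicCompletion ℚ) (((q : ℤ) * m : ℤ) : ℚ), hmem⟩ with hϖ_def
  have h1 : algebraMap 𝒪[v.adicCompletion ℚ] (AlgebraicClosure (v.adicCompletion ℚ)) ϖ =
      ((((q : ℤ) * m : ℤ) : ℚ) : AlgebraicClosure (v.adicCompletion ℚ)) := by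
    rw [hϖ_def, IsScalarTower.algebraMap_apply 𝒪[v.adicCompletion ℚ] (v.adicCompletion ℚ)
      (AlgebraicClosure (v.adicCompletion ℚ))]
    change algebraMap (v.adicCompletion ℚ) (AlgebraicClosure (v.adicCompletion ℚ))
      (algebraMap ℚ (v.adicCompletion ℚ) (((q : ℤ) * m : ℤ) : ℚ)) = _
    rw [eq_ratCast, map_ratCast]
  haveI : CharZero (v.adicCompletion ℚ) := charZero_adicCompletion (K := ℚ) v
  -- `z = ι(α) / q^k`, `z² = ϖ`
  have hq0 : (algebraMap ℚ (AlgebraicClosure (v.adicCompletion ℚ)) ((q : ℚ) ^ k)) ≠ 0 := by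
    rw [map_pow]
    exact pow_ne_zero _ ((map_ne_zero _).mpr (Nat.cast_ne_zero.mpr hq.ne_zero))
  set z := ι α * (algebraMap ℚ (AlgebraicClosure (v.adicCompletion ℚ)) ((q : ℚ) ^ k))⁻¹ with hz_def
  have hz : z ^ 2 = algebraMap 𝒪[v.adicCompletion ℚ] (AlgebraicClosure (v.adicCompletion ℚ)) ϖ := by
    rw [h1, hz_def, mul_pow, ← map_pow ι, ← hα, eq_ratCast, map_ratCast, eq_ratCast, ha]
    have hqF : (q : AlgebraicClosure (v.adicCompletion ℚ)) ≠ 0 := by exact_mod_cast hq.ne_zero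
    push_cast
    field_simp
    ring
  obtain ⟨σ, hσI, hσ⟩ := exists_mem_absInertia_smul_eq_mul two_pos hϖ hz (ζ := -1) (by norm_num)
  refine ⟨σ, hσI, ?_⟩
  have hfix : σ • (algebraMap ℚ (AlgebraicClosure (v.adicCompletion ℚ)) ((q : ℚ) ^ k)) =
      algebraMap ℚ (AlgebraicClosure (v.adicCompletion ℚ)) ((q : ℚ) ^ k) := by
    rw [IsScalarTower.algebraMap_apply ℚ (v.adicCompletion ℚ) (AlgebraicClosure (v.adicCompletion ℚ)),
      absoluteGaloisGroup.smul_def, AlgEquiv.commutes]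
  have hια : ι α = z * algebraMap ℚ (AlgebraicClosure (v.adicCompletion ℚ)) ((q : ℚ) ^ k) := by
    rw [hz_def, inv_mul_cancel_right₀ hq0]
  rw [hια, smul_mul', hσ, hfix, neg_one_mul, neg_mul]

/-- **At a prime `q ≡ 3 (mod 4)`, a square root of `-1` in `\bar{ℚ_q}` is fixed by inertia and
negated by every arithmetic Frobenius** (`ℚ_q(i)/ℚ_q` is the unramified quadratic extension:
`i^q = i³ = -i`). [cite: SerreLocalFields1979, Ch. IV §4 Prop. 16] -/
theorem adicCompletion_rat_sqrt_neg_one {q : ℕ} [Fact q.Prime] (hv : (primesEquiv v : ℕ) = q)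
    (hq : q % 4 = 3) (t : AlgebraicClosure (v.adicCompletion ℚ)) (ht : t ^ 2 = -1) :
    (∀ σ ∈ absInertia (v.adicCompletion ℚ), σ • t = t) ∧
      ∀ τ : absoluteGaloisGroup (v.adicCompletion ℚ), IsAbsArithFrob τ → τ • t = -t := by
  have hqp : q.Prime := Fact.out
  have ht4 : t ^ 4 = 1 := by
    rw [show (4 : ℕ) = 2 * 2 from rfl, pow_mul, ht]; norm_num
  have hchar := ringChar_residueField_adicCompletion_rat q v hv
  have hq4 : ¬ ringChar 𝓀[v.adicCompletion ℚ] ∣ 4 := by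
    rw [hchar]
    intro h
    have h2 : q ∣ 2 ^ 2 := h
    have := (Nat.prime_dvd_prime_iff_eq hqp Nat.prime_two).mp (hqp.dvd_of_dvd_pow h2)
    omega
  refine ⟨fun σ hσ => smul_eq_self_of_pow_eq_one_of_mem_absInertia hσ (by norm_num) hq4 ht4,
    fun τ hτ => ?_⟩
  have hτ1 : IsFrobPow τ ((1 : ℕ) : ℤ) := IsAbsArithFrob.isFrobPow_holds hτ
  rw [LocalWeilDatum.smul_eq_pow_of_isFrobPow (v.adicCompletion ℚ) hq4 (by norm_num) hτ1 ht4, pow_one,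
    residueFieldCard_adicCompletion_rat q v hv]
  obtain ⟨j, hj⟩ : ∃ j, q = 4 * j + 3 := ⟨q / 4, by omega⟩
  rw [hj, pow_add, pow_mul, ht4, one_pow, one_mul, pow_succ, ht]
  ring

end RatOddPlace

/-! ### Auxiliary: `ℚ(i) ⊂ ℚ̄`, complex conjugation, square-root characters, the dictionary `ℤ/2 ≅ (1/2)ℤ/ℤ` -/

section Setup

open IsCyclotomicExtension

/-- **`Gal(ℚ̄/ℚ(i)) = Stab(i)` and complex conjugation.**  There are `i₀ ∈ ℚ̄` with `i₀² = -1`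
and an involution `c ∈ Γ_ℚ` (a complex conjugation) with `c i₀ = -i₀`, such that the image of
`Γ_{ℚ(i)} → Γ_ℚ` (`absGaloisRestrict`) is the stabiliser of `i₀`, and every `x ∈ Γ_ℚ` maps `i₀`
to `±i₀`. [folklore] -/
theorem rat_cyclotomicFour_setup
    [IsCyclotomicExtension {4} ℚ (CyclotomicField 4 ℚ)] :
    ∃ (i₀ : AlgebraicClosure ℚ) (c : absoluteGaloisGroup ℚ), i₀ ^ 2 = -1 ∧ c * c = 1 ∧
      c • i₀ = -i₀ ∧
      (∀ x : absoluteGaloisGroup ℚ,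
        x ∈ (absGaloisRestrict ℚ (CyclotomicField 4 ℚ) :
          absoluteGaloisGroup (CyclotomicField 4 ℚ) →* absoluteGaloisGroup ℚ).range ↔ x • i₀ = i₀) ∧
      ∀ x : absoluteGaloisGroup ℚ, x • i₀ = i₀ ∨ x • i₀ = -i₀ := by
  classical
  obtain ⟨e, he⟩ := exists_mem_range_absGaloisRestrict_iff ℚ (CyclotomicField 4 ℚ)
  have hζ := zeta_spec 4 ℚ (CyclotomicField 4 ℚ)
  set i₀ := e (zeta 4 ℚ (CyclotomicField 4 ℚ)) with hi₀_def
  -- `ζ² = -1`, `i₀² = -1`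
  have hζ2 : (zeta 4 ℚ (CyclotomicField 4 ℚ)) ^ 2 = -1 := by
    have h4 : ((zeta 4 ℚ (CyclotomicField 4 ℚ)) ^ 2) ^ 2 = 1 := by
      rw [← pow_mul]; exact hζ.pow_eq_one
    rcases sq_eq_one_iff.mp h4 with h | h
    · exact absurd h (hζ.pow_ne_one_of_pos_of_lt (by norm_num) (by norm_num))
    · exact h
  have hi₀ : i₀ ^ 2 = -1 := by rw [hi₀_def, ← map_pow, hζ2, map_neg, map_one]
  have hi₀0 : i₀ ≠ 0 := fun h => by
    rw [h] at hi₀; norm_num at hi₀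
  -- every `x` maps `i₀` to `±i₀`
  have hpm : ∀ x : absoluteGaloisGroup ℚ, x • i₀ = i₀ ∨ x • i₀ = -i₀ := fun x =>
    sq_eq_sq_iff_eq_or_eq_neg.mp (by rw [← smul_pow', hi₀, smul_neg, smul_one])
  -- the range of `Γ_{ℚ(i)} → Γ_ℚ` is the stabiliser of `i₀`
  have hS : ∀ x : absoluteGaloisGroup ℚ,
      x ∈ (absGaloisRestrict ℚ (CyclotomicField 4 ℚ) :
        absoluteGaloisGroup (CyclotomicField 4 ℚ) →* absoluteGaloisGroup ℚ).range ↔ x • i₀ = i₀ := by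
    intro x
    rw [show x ∈ (absGaloisRestrict ℚ (CyclotomicField 4 ℚ) :
        absoluteGaloisGroup (CyclotomicField 4 ℚ) →* absoluteGaloisGroup ℚ).range ↔
        x ∈ (absGaloisRestrict ℚ (CyclotomicField 4 ℚ)).range from Iff.rfl, he x]
    refine ⟨fun h => h _, fun h y => ?_⟩
    -- `{y | x • e y = e y}` is a subalgebra containing `ζ₄`, and `ℚ(ζ₄) = ℚ[ζ₄]`
    have hy : y ∈ Algebra.adjoin ℚ ({zeta 4 ℚ (CyclotomicField 4 ℚ)} : Set (CyclotomicField 4 ℚ)) := by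
      rw [IsCyclotomicExtension.adjoin_primitive_root_eq_top hζ]; trivial
    refine Algebra.adjoin_induction (p := fun y _ => x • e y = e y) ?_ ?_ ?_ ?_ hy
    · intro t ht
      rw [Set.mem_singleton_iff.mp ht]
      exact h
    · intro r
      rw [AlgHom.commutes, eq_ratCast, absoluteGaloisGroup.smul_def, map_ratCast]
    · intro a b _ _ ha hb
      rw [map_add, smul_add, ha, hb]
    · intro a b _ _ ha hb
      rw [map_mul, smul_mul', ha, hb]
  -- a complex conjugation `c`, with `c i₀ = -i₀`
  obtain ⟨c, hc⟩ := exists_isComplexConjugation (Rat.castHom ℝ)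
  obtain ⟨ι, -, hιc⟩ := isComplexConjugation_iff.mp hc
  have hci₀ : c • i₀ = -i₀ := by
    apply ι.injective
    rw [hιc, map_neg]
    have hw : (ι i₀) ^ 2 = Complex.I ^ 2 := by rw [← map_pow, hi₀, map_neg, map_one, Complex.I_sq]
    rcases sq_eq_sq_iff_eq_or_eq_neg.mp hw with h | h <;> rw [h]
    · exact Complex.conj_I
    · rw [map_neg, Complex.conj_I, neg_neg]
  have hcc : c * c = 1 := by rw [← pow_two]; exact hc.sq_eq_one
  exact ⟨i₀, c, hi₀, hcc, hci₀, hS, hpm⟩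

/-- A locally constant function on a clopen subset, extended by a constant, is locally constant.
[folklore] -/
theorem isLocallyConstant_dite_mem {X Y : Type*} [TopologicalSpace X] {s : Set X}
    [DecidablePred (· ∈ s)] (hs : IsClopen s) {f : s → Y} (hf : IsLocallyConstant f) (y₀ : Y) :
    IsLocallyConstant fun x => if hx : x ∈ s then f ⟨x, hx⟩ else y₀ := by
  rw [IsLocallyConstant.iff_exists_open]
  intro x
  by_cases hx : x ∈ s
  · obtain ⟨U, hU, hxU, hUf⟩ := hf.exists_open ⟨x, hx⟩
    obtain ⟨V, hV, rfl⟩ := isOpen_induced_iff.mp hU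
    refine ⟨V ∩ s, hV.inter hs.isOpen, ⟨hxU, hx⟩, fun y hy => ?_⟩
    rw [dif_pos hy.2, dif_pos hx]
    exact hUf ⟨y, hy.2⟩ hy.1
  · refine ⟨sᶜ, hs.compl.isOpen, hx, fun y hy => ?_⟩
    rw [dif_neg (show y ∉ s from hy), dif_neg hx]

/-- **The dictionary `ℤ/2 ≅ (1/2)ℤ/ℤ ⊂ ℚ/ℤ`**: an additive embedding `e : ℤ/2 → ℚ/ℤ` onto the
`2`-torsion, with a set-theoretic inverse `ψ` additive on `2`-torsion elements, `e 1 = 1/2`.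
[folklore] -/
theorem zmodTwo_addCircle_dictionary :
    ∃ (e : ZMod 2 →+ AddCircle (1 : ℚ)) (ψ : AddCircle (1 : ℚ) → ZMod 2), Function.Injective e ∧
      (∀ k, ψ (e k) = k) ∧ (∀ x, 2 • x = 0 → e (ψ x) = x) ∧
      (∀ x y, 2 • x = 0 → 2 • y = 0 → ψ (x + y) = ψ x + ψ y) ∧ (∀ k, 2 • e k = 0) ∧
      e 1 = (((1 : ℚ) / 2 : ℚ) : AddCircle (1 : ℚ)) := by
  classical
  obtain ⟨e, he_inj, he_apply, he_surj⟩ := zmod_exists_addMonoidHom_addCircle (N := 2) two_pos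
  have hpre : ∀ x : AddCircle (1 : ℚ), ∃ k : ZMod 2, 2 • x = 0 → e k = x := fun x => by
    by_cases hx : 2 • x = 0
    · obtain ⟨k, hk⟩ := he_surj x hx
      exact ⟨k, fun _ => hk⟩
    · exact ⟨0, fun h => absurd h hx⟩
  choose ψ hψ using hpre
  have hpe : ∀ k : ZMod 2, 2 • e k = 0 := fun k => by
    rw [← map_nsmul, nsmul_eq_mul, show ((2 : ℕ) : ZMod 2) = 0 from rfl, zero_mul, map_zero]
  have hψe : ∀ k, ψ (e k) = k := fun k => he_inj (hψ _ (hpe k))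
  refine ⟨e, ψ, he_inj, hψe, hψ, fun x y hx hy => ?_, hpe, ?_⟩
  · apply he_inj
    rw [map_add, hψ x hx, hψ y hy, hψ (x + y) (by rw [nsmul_add, hx, hy, add_zero])]
  · have h := he_apply 1
    rw [Int.cast_one] at h
    rw [h]
    norm_num

variable {L : Type*} [Field L]

/-- **Sign characters of square roots.**  If `σ ρ = ±ρ` and `τ ρ = ±ρ` (`ρ ≠ 0`, `char ≠ 2`) then
the indicators `[· ρ ≠ ρ] ∈ ℤ/2` add: `[στ ρ ≠ ρ] = [σ ρ ≠ ρ] + [τ ρ ≠ ρ]`. [folklore] -/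
theorem sqrt_indicator_mul [CharZero L] [DecidableEq (AlgebraicClosure L)]
    {ρ : AlgebraicClosure L} (hρ : ρ ≠ 0)
    {σ τ : absoluteGaloisGroup L} (hσ : σ • ρ = ρ ∨ σ • ρ = -ρ) (hτ : τ • ρ = ρ ∨ τ • ρ = -ρ) :
    (if (σ * τ) • ρ = ρ then (0 : ZMod 2) else 1) =
      (if σ • ρ = ρ then (0 : ZMod 2) else 1) + (if τ • ρ = ρ then (0 : ZMod 2) else 1) := by
  have hne : -ρ ≠ ρ := fun h => hρ (by
    have h2 : ρ + ρ = 0 := by nth_rewrite 1 [← h]; exact neg_add_cancel ρ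
    rwa [← two_mul, mul_eq_zero, or_iff_right two_ne_zero] at h2)
  rcases hσ with h1 | h1 <;> rcases hτ with h2 | h2 <;>
    simp only [mul_smul, h2, h1, smul_neg, neg_neg, if_true, hne, if_false]
  · rw [add_zero]
  · rw [zero_add]
  · rw [add_zero]
  · rw [CharTwo.add_self_eq_zero]

/-- **Sign indicator of a product**: if `σ u = ±u`, `σ w = ±w` (`u w ≠ 0`, `char ≠ 2`) then
`[σ (u w) ≠ u w] = [σ u ≠ u] + [σ w ≠ w]` in `ℤ/2`. [folklore] -/
theorem sqrt_indicator_smul_mul [CharZero L] [DecidableEq (AlgebraicClosure L)]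
    {u w : AlgebraicClosure L} (hu : u ≠ 0) (hw : w ≠ 0)
    {σ : absoluteGaloisGroup L} (hσu : σ • u = u ∨ σ • u = -u) (hσw : σ • w = w ∨ σ • w = -w) :
    (if σ • (u * w) = u * w then (0 : ZMod 2) else 1) =
      (if σ • u = u then (0 : ZMod 2) else 1) + (if σ • w = w then (0 : ZMod 2) else 1) := by
  have hne : ∀ {t : AlgebraicClosure L}, t ≠ 0 → -t ≠ t := fun {t} ht h => ht (by
    have h2 : t + t = 0 := by nth_rewrite 1 [← h]; exact neg_add_cancel t
    rwa [← two_mul, mul_eq_zero, or_iff_right two_ne_zero] at h2)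
  have huw : u * w ≠ 0 := mul_ne_zero hu hw
  rcases hσu with h1 | h1 <;> rcases hσw with h2 | h2 <;>
    simp only [smul_mul', h1, h2, neg_mul, mul_neg, neg_neg, if_true, hne hu, hne hw, hne huw,
      if_false]
  · rw [add_zero]
  · rw [zero_add]
  · rw [add_zero]
  · rw [CharTwo.add_self_eq_zero]

end Setup

/-! ### The main theorem at `p = 2` -/

section Main

open IsCyclotomicExtension Rat.HeightOneSpectrum

/-- **A finite-locally trivial `2`-torsion `2`-cocycle on `Γ_ℚ` splits, granted the Hasse
principle for `Br(ℚ(i))`** (Serre, Durham §6.5, `p = 2`).  See the module docstring for the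
proof (descent through `ℚ(i)`, explicit Gysin sequence, Kummer theory, the tame symbol at the
primes `q ≡ 3 (4)`, Fermat's two-squares theorem and the explicit splitting of
`χ_{-1} ∪ χ_{x²+y²}`, the Bockstein of `χ_{-1}` at `2`).
[cite: SerreDurham1977, §6.5] [cite: Harari2020, Thm. 14.11] -/
theorem twoCocycle_addCircle_two_split_rat_of_locallyTrivial
    (hB : brauerHassePrinciple (CyclotomicField 4 ℚ))
    (z : absoluteGaloisGroup ℚ → absoluteGaloisGroup ℚ → AddCircle (1 : ℚ))
    (hz_lc : IsLocallyConstant (Function.uncurry z))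
    (hz_coc : ∀ σ τ υ, z σ τ + z (σ * τ) υ = z τ υ + z σ (τ * υ)) (hz_2 : ∀ σ τ, 2 • z σ τ = 0)
    (hz_loc : ∀ v : HeightOneSpectrum (𝓞 ℚ),
      ∃ β : absoluteGaloisGroup (v.adicCompletion ℚ) → AddCircle (1 : ℚ), IsLocallyConstant β ∧
        (∀ σ τ, z (absGaloisRestrict ℚ (v.adicCompletion ℚ) σ)
            (absGaloisRestrict ℚ (v.adicCompletion ℚ) τ) + β (σ * τ) = β σ + β τ) ∧
        ∀ σ, 2 • β σ = 0) :
    ∃ b : absoluteGaloisGroup ℚ → AddCircle (1 : ℚ), IsLocallyConstant b ∧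
      ∀ σ τ, z σ τ + b (σ * τ) = b σ + b τ := by
  classical
  haveI : IsCyclotomicExtension {4} ℚ (CyclotomicField 4 ℚ) :=
    CyclotomicField.isCyclotomicExtension 4 ℚ
  haveI : NumberField (CyclotomicField 4 ℚ) := IsCyclotomicExtension.numberField {4} ℚ _
  have hζK := zeta_spec 4 ℚ (CyclotomicField 4 ℚ)
  have hA : ∀ a : ZMod 2, a + a = 0 := CharTwo.add_self_eq_zero
  have h01 : ∀ t : ZMod 2, t = 0 ∨ t = 1 := by decide
  -- Step 2: the Hasse input over `ℚ(i)` (all infinite places complex, `μ_2 ⊂ ℚ(i)`)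
  have hcx : ∀ w : InfinitePlace (CyclotomicField 4 ℚ), w.IsComplex := by
    intro w
    rw [← InfinitePlace.not_isReal_iff_isComplex]
    intro hw
    have h0 := NumberField.InfinitePlace.IsPrimitiveRoot.nrRealPlaces_eq_zero_of_two_lt
      (by norm_num) hζK
    have : 0 < NumberField.InfinitePlace.nrRealPlaces (CyclotomicField 4 ℚ) :=
      Fintype.card_pos_iff.mpr ⟨⟨w, hw⟩⟩
    omega
  obtain ⟨bK, hbK_lc, hbK2, hbK⟩ := hasseInput_of_brauerHassePrinciple (CyclotomicField 4 ℚ)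
    Nat.prime_two (IsPrimitiveRoot.neg_one 0 (by norm_num)) (Or.inr hcx) hB z hz_lc hz_coc hz_2
    hz_loc
  -- Step 3: `i₀`, `c`, `S = Gal(ℚ̄/ℚ(i)) = Stab(i₀)`
  obtain ⟨i₀, c, hi₀, hcc, hci₀, hS, hpm⟩ := rat_cyclotomicFour_setup
  set i := absGaloisRestrict ℚ (CyclotomicField 4 ℚ) with hi_def
  set S : Subgroup (absoluteGaloisGroup ℚ) :=
    (absGaloisRestrict ℚ (CyclotomicField 4 ℚ) :
      absoluteGaloisGroup (CyclotomicField 4 ℚ) →* absoluteGaloisGroup ℚ).range with hS_def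
  have hi₀0 : i₀ ≠ 0 := fun h => by rw [h] at hi₀; norm_num at hi₀
  have hneg : ∀ {t : AlgebraicClosure ℚ}, t ≠ 0 → -t ≠ t := fun {t} ht h => ht (by
    have h2 : t + t = 0 := by nth_rewrite 1 [← h]; exact neg_add_cancel t
    rwa [← two_mul, mul_eq_zero, or_iff_right two_ne_zero] at h2)
  have hSc : ∀ x, x ∉ S → x * c ∈ S := fun x hx => by
    rw [hS] at hx ⊢
    rcases hpm x with h | h
    · exact absurd h hx
    · rw [mul_smul, hci₀, smul_neg, h, neg_neg]
  have hnorm : ∀ h ∈ S, c * h * c ∈ S := fun h hh => by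
    rw [hS] at hh ⊢
    rw [mul_smul, mul_smul, hci₀, smul_neg, hh, smul_neg, hci₀, neg_neg]
  have hSmem : ∀ x, x ∈ S ↔ x • i₀ = i₀ := hS
  have hSnot : ∀ x, x ∉ S ↔ x • i₀ = -i₀ := fun x => by
    rw [hSmem]
    constructor
    · intro h; rcases hpm x with h' | h'
      · exact absurd h' h
      · exact h'
    · intro h h'; rw [h'] at h; exact hneg hi₀0 h.symm
  -- `S` is open (closed of index `2`)
  have hSclosed : IsClosed (S : Set (absoluteGaloisGroup ℚ)) := by
    rw [hS_def, MonoidHom.coe_range]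
    exact isClosed_range_absGaloisRestrict ℚ (CyclotomicField 4 ℚ)
  have hSidx : S.index = 2 := by
    have h1 : S.index = Module.finrank ℚ (CyclotomicField 4 ℚ) := by
      rw [hS_def]; exact index_range_absGaloisRestrict_eq_finrank ℚ (CyclotomicField 4 ℚ)
    rw [h1, IsCyclotomicExtension.finrank (CyclotomicField 4 ℚ)
      (Polynomial.cyclotomic.irreducible_rat (by norm_num : 0 < 4))]
    decide
  haveI : S.FiniteIndex := ⟨by rw [hSidx]; norm_num⟩
  have hSopen : IsOpen (S : Set (absoluteGaloisGroup ℚ)) := S.isOpen_of_isClosed_of_finiteIndex hSclosed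
  have hSclopen : IsClopen (S : Set (absoluteGaloisGroup ℚ)) := ⟨hSclosed, hSopen⟩
  -- Step 4: pass to `ℤ/2`-valued cochains
  obtain ⟨e, ψ, he_inj, hψe, heψ, hψ_add, he2, he1⟩ := zmodTwo_addCircle_dictionary
  set z₂ : absoluteGaloisGroup ℚ → absoluteGaloisGroup ℚ → ZMod 2 := fun x y => ψ (z x y) with hz₂
  have hz₂_lc : IsLocallyConstant (Function.uncurry z₂) := hz_lc.comp ψ
  have hz₂_coc : ∀ σ τ υ, z₂ σ τ + z₂ (σ * τ) υ = z₂ τ υ + z₂ σ (τ * υ) := fun σ τ υ => by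
    simp only [hz₂]
    rw [← hψ_add _ _ (hz_2 _ _) (hz_2 _ _), ← hψ_add _ _ (hz_2 _ _) (hz_2 _ _), hz_coc]
  -- the splitting on `S`, transported from `Γ_{ℚ(i)}` along `Γ_{ℚ(i)} ≃ₜ* S`
  set eS : absoluteGaloisGroup (CyclotomicField 4 ℚ) ≃ₜ* S :=
    continuousMulEquivRangeOfInjective (absGaloisRestrict ℚ (CyclotomicField 4 ℚ))
      (absGaloisRestrict_injective ℚ (CyclotomicField 4 ℚ)) with heS
  have heS_coe : ∀ σ, ((eS σ : S) : absoluteGaloisGroup ℚ) = i σ := fun σ => rfl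
  set β₂ : absoluteGaloisGroup ℚ → ZMod 2 :=
    fun x => if hx : x ∈ S then ψ (bK (eS.symm ⟨x, hx⟩)) else 0 with hβ₂
  have hβ₂_lc : IsLocallyConstant β₂ :=
    isLocallyConstant_dite_mem hSclopen
      ((hbK_lc.comp_continuous (map_continuous eS.symm)).comp ψ) 0
  have hβ₂S : ∀ h ∈ S, ∀ k ∈ S, z₂ h k + β₂ (h * k) = β₂ h + β₂ k := fun h hh k hk => by
    simp only [hz₂, hβ₂]
    rw [dif_pos hh, dif_pos hk, dif_pos (S.mul_mem hh hk)]
    have hmul : eS.symm ⟨h * k, S.mul_mem hh hk⟩ = eS.symm ⟨h, hh⟩ * eS.symm ⟨k, hk⟩ := by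
      rw [← map_mul]; rfl
    have key := hbK (eS.symm ⟨h, hh⟩) (eS.symm ⟨k, hk⟩)
    have e1 : i (eS.symm ⟨h, hh⟩) = h := by
      rw [← heS_coe, ContinuousMulEquiv.apply_symm_apply]
    have e2 : i (eS.symm ⟨k, hk⟩) = k := by
      rw [← heS_coe, ContinuousMulEquiv.apply_symm_apply]
    rw [e1, e2, ← hmul] at key
    rw [← hψ_add _ _ (hz_2 _ _) (hbK2 _), key, hψ_add _ _ (hbK2 _) (hbK2 _)]
  -- Step 5: the explicit Gysin sequence: `z₂ = χ_S ∪ w₂ + ∂δ₂`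
  obtain ⟨w₂, δ₂, hw₂_lc, hδ₂_lc, hw₂_add, hdec⟩ :=
    twoCocycle_indexTwo_eq_cup_add_coboundary hA S hSopen c hcc hSc hnorm z₂ hz₂_lc hz₂_coc β₂
      hβ₂_lc hβ₂S
  -- Step 6: local triviality of `u = χ_S ∪ w₂` at every finite place, in `ℤ/2` form
  have hloc₂ : ∀ v : HeightOneSpectrum (𝓞 ℚ),
      ∃ B : absoluteGaloisGroup (v.adicCompletion ℚ) → ZMod 2, IsLocallyConstant B ∧
        ∀ x y, B (x * y) = B x + B y +
          (if absGaloisRestrict ℚ (v.adicCompletion ℚ) x ∈ S then 0 else 1) *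
            w₂ (absGaloisRestrict ℚ (v.adicCompletion ℚ) y) := by
    intro v
    obtain ⟨βv, hβv_lc, hβv, hβv2⟩ := hz_loc v
    set r := absGaloisRestrict ℚ (v.adicCompletion ℚ) with hr
    refine ⟨fun x => ψ (βv x) + δ₂ (r x), (hβv_lc.comp ψ).comp₂ (hδ₂_lc.comp_continuous r.continuous)
      fun a b => a + b, fun x y => ?_⟩
    have key := hβv x y
    -- `z (r x) (r y) = βv x + βv y - βv (xy)`; apply `ψ`
    have hz_eq : z (r x) (r y) = βv x + βv y - βv (x * y) := eq_sub_of_add_eq key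
    have hψz : ψ (z (r x) (r y)) = ψ (βv x) + ψ (βv y) + ψ (βv (x * y)) := by
      have h2 : 2 • (βv x + βv y - βv (x * y)) = 0 := by
        rw [nsmul_sub, nsmul_add, hβv2, hβv2, hβv2, add_zero, sub_zero]
      have hneg2 : ∀ t : AddCircle (1 : ℚ), 2 • t = 0 → -t = t := fun t ht => by
        rw [neg_eq_iff_add_eq_zero, ← two_nsmul, ht]
      rw [hz_eq, sub_eq_add_neg, hneg2 _ (hβv2 _),
        hψ_add _ _ (by rw [nsmul_add, hβv2, hβv2, add_zero]) (hβv2 _), hψ_add _ _ (hβv2 _) (hβv2 _)]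
    have hd := hdec (r x) (r y)
    simp only [hz₂] at hd
    rw [hψz] at hd
    -- `hd : ψβx + ψβy + ψβ(xy) = χ w + (δ rx + δ ry + δ (rx ry))`
    show ψ (βv (x * y)) + δ₂ (r (x * y)) =
      (ψ (βv x) + δ₂ (r x)) + (ψ (βv y) + δ₂ (r y)) + (if r x ∈ S then 0 else 1) * w₂ (r y)
    rw [map_mul]
    calc ψ (βv (x * y)) + δ₂ (r x * r y)
        = ψ (βv (x * y)) + δ₂ (r x * r y) + ((ψ (βv x) + δ₂ (r x) + (ψ (βv y) + δ₂ (r y))) +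
            (ψ (βv x) + δ₂ (r x) + (ψ (βv y) + δ₂ (r y)))) := by rw [hA, add_zero]
      _ = (ψ (βv x) + δ₂ (r x)) + (ψ (βv y) + δ₂ (r y)) +
            ((ψ (βv x) + ψ (βv y) + ψ (βv (x * y))) + (δ₂ (r x) + δ₂ (r y) + δ₂ (r x * r y))) := by
          abel
      _ = (ψ (βv x) + δ₂ (r x)) + (ψ (βv y) + δ₂ (r y)) +
            ((if r x ∈ S then 0 else w₂ (r y)) + (δ₂ (r x) + δ₂ (r y) + δ₂ (r x * r y)) +
              (δ₂ (r x) + δ₂ (r y) + δ₂ (r x * r y))) := by rw [hd]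
      _ = (ψ (βv x) + δ₂ (r x)) + (ψ (βv y) + δ₂ (r y)) + (if r x ∈ S then 0 else w₂ (r y)) := by
          rw [add_assoc (if r x ∈ S then 0 else w₂ (r y)), hA, add_zero]
      _ = _ := by
          split_ifs <;> simp
  -- Step 7: Kummer theory: `w₂ = χ_α`, `α² = a ∈ ℚ`; integral normalisation `α₁ = den(a) α`
  obtain ⟨α, a, hα0, hαa, hαpm, hwα⟩ :=
    exists_kummer_generator_of_quadratic_character ℚ w₂ hw₂_add hw₂_lc
  set A : ℤ := a.num * a.den with hA_def
  set α₁ : AlgebraicClosure ℚ := ((a.den : ℚ) : AlgebraicClosure ℚ) * α with hα₁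
  have hden0 : ((a.den : ℚ) : AlgebraicClosure ℚ) ≠ 0 := by exact_mod_cast a.den_ne_zero
  have hα₁0 : α₁ ≠ 0 := mul_ne_zero hden0 hα0
  have hα₁sq : α₁ ^ 2 = ((A : ℚ) : AlgebraicClosure ℚ) := by
    have h1 : ((a.den : ℚ)) ^ 2 * a = (A : ℚ) := by
      rw [hA_def, sq, mul_assoc, mul_comm (a.den : ℚ) a, Rat.mul_den_eq_num]
      push_cast; ring
    rw [hα₁, mul_pow, ← hαa, eq_ratCast, ← Rat.cast_pow, ← Rat.cast_mul, h1]
  have hfixQ : ∀ (σ : absoluteGaloisGroup ℚ) (t : ℚ), σ • (t : AlgebraicClosure ℚ) = t := fun σ t => by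
    rw [absoluteGaloisGroup.smul_def, map_ratCast]
  have hσα₁ : ∀ σ : absoluteGaloisGroup ℚ, σ • α₁ = ((a.den : ℚ) : AlgebraicClosure ℚ) * σ • α :=
    fun σ => by rw [hα₁, smul_mul', hfixQ]
  have hα₁pm : ∀ σ : absoluteGaloisGroup ℚ, σ • α₁ = α₁ ∨ σ • α₁ = -α₁ := fun σ => by
    rw [hσα₁]
    rcases hαpm σ with h | h <;> rw [h]
    · exact Or.inl rfl
    · exact Or.inr (mul_neg _ _)
  have hw₁ : ∀ σ : absoluteGaloisGroup ℚ, w₂ σ = 0 ↔ σ • α₁ = α₁ := fun σ => by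
    rw [hwα σ, hσα₁, hα₁]
    exact ⟨fun h => by rw [h], fun h => mul_left_cancel₀ hden0 h⟩
  have ha0 : a ≠ 0 := fun h => hα0 (by
    rw [h, map_zero] at hαa
    exact pow_eq_zero_iff two_ne_zero |>.mp hαa.symm)
  have hA0 : A ≠ 0 := mul_ne_zero (Rat.num_ne_zero.mpr ha0) (by exact_mod_cast a.den_ne_zero)
  set n : ℕ := A.natAbs with hn
  have hn0 : n ≠ 0 := Int.natAbs_ne_zero.mpr hA0
  have hsign1 : A.sign.natAbs = 1 := Int.natAbs_sign_of_ne_zero hA0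
  -- Steps 8–9: `v_q(|A|)` is even for every prime `q ≡ 3 (mod 4)`
  have heven : ∀ q : ℕ, q.Prime → q % 4 = 3 → Even (padicValNat q n) := by
    intro q hq hq3
    by_contra hodd
    rw [Nat.not_even_iff_odd] at hodd
    obtain ⟨k, hk⟩ := hodd
    -- `n = q^(2k+1) m'` with `q ∤ m'`
    have hfq : n.factorization q = 2 * k + 1 := by rw [Nat.factorization_def n hq, hk]
    have hfac : q ^ (2 * k + 1) * (n / q ^ (2 * k + 1)) = n := by
      rw [← hfq]; exact Nat.ordProj_mul_ordCompl_eq_self n q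
    have hndvd : ¬ q ∣ n / q ^ (2 * k + 1) := by
      rw [← hfq]; exact Nat.not_dvd_ordCompl hq hn0
    set m' : ℕ := n / q ^ (2 * k + 1) with hm'
    have hAeq : A = (q : ℤ) ^ (2 * k + 1) * (A.sign * m') := by
      conv_lhs => rw [← Int.sign_mul_natAbs A, ← hn, ← hfac]
      push_cast; ring
    have hm : ¬ (q : ℤ) ∣ A.sign * m' := by
      intro h
      rw [Int.natCast_dvd, Int.natAbs_mul, hsign1, one_mul, Int.natAbs_natCast] at h
      exact hndvd h
    -- the place `v` above `q`
    haveI : Fact q.Prime := ⟨hq⟩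
    set vq : HeightOneSpectrum (𝓞 ℚ) := (primesEquiv (R := 𝓞 ℚ)).symm ⟨q, hq⟩ with hvq_def
    have hvq : (primesEquiv vq : ℕ) = q := by
      rw [hvq_def, Equiv.apply_symm_apply]
    set r := absGaloisRestrict ℚ (vq.adicCompletion ℚ) with hr
    set ι := absClosureEmbedding ℚ (vq.adicCompletion ℚ) with hι
    have happly : ∀ (x : absoluteGaloisGroup (vq.adicCompletion ℚ)) (m : AlgebraicClosure ℚ),
        ι ((r x) • m) = x • ι m := fun x m => absGaloisRestrict_apply_smul ℚ _ x m
    -- NB: `CharZero ℚ_v` only now (it changes the `ℚ`-algebra instance found for `ℚ_v`)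
    haveI : CharZero (vq.adicCompletion ℚ) := charZero_adicCompletion (K := ℚ) vq
    have hneg' : ∀ {t : AlgebraicClosure (vq.adicCompletion ℚ)}, t ≠ 0 → -t ≠ t := fun {t} ht h => ht (by
      have h2 : t + t = 0 := by nth_rewrite 1 [← h]; exact neg_add_cancel t
      rwa [← two_mul, mul_eq_zero, or_iff_right two_ne_zero] at h2)
    -- (A1) inertia moves `α₁`
    obtain ⟨σ₀, hσ₀I, hσ₀⟩ := adicCompletion_rat_exists_mem_absInertia_smul_eq_neg vq hq hvq hAeq hm
      α₁ (by rw [eq_ratCast, hα₁sq])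
    -- (A2) `√-1` at `q`
    have ht : (ι i₀) ^ 2 = -1 := by rw [← map_pow, hi₀, map_neg, map_one]
    have ht0 : ι i₀ ≠ 0 := fun h => by rw [h] at ht; norm_num at ht
    obtain ⟨htI, htφ⟩ := adicCompletion_rat_sqrt_neg_one vq hvq hq3 (ι i₀) ht
    -- the local data
    obtain ⟨Bv, hBv_lc, hBvid⟩ := hloc₂ vq
    set X : absoluteGaloisGroup (vq.adicCompletion ℚ) → ZMod 2 := fun x => if r x ∈ S then 0 else 1
      with hX
    set W : absoluteGaloisGroup (vq.adicCompletion ℚ) → ZMod 2 := fun x => w₂ (r x) with hW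
    have hrS : ∀ x, r x ∈ S ↔ x • ι i₀ = ι i₀ := fun x => by
      rw [hSmem, ← happly]
      exact ι.injective.eq_iff.symm
    have hXadd : ∀ x y, X (x * y) = X x + X y := fun x y => by
      simp only [hX, map_mul]
      exact indexTwo_indicator_mul S c hcc hSc hnorm _ _
    have hWadd : ∀ x y, W (x * y) = W x + W y := fun x y => by
      simp only [hW, map_mul, hw₂_add]
    have hXI : ∀ σ ∈ absInertia (vq.adicCompletion ℚ), X σ = 0 := fun σ hσ => by
      simp only [hX]
      rw [if_pos ((hrS σ).mpr (htI σ hσ))]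
    have hXφ : ∀ τ, IsAbsArithFrob τ → X τ = 1 := fun τ hτ => by
      simp only [hX]
      rw [if_neg]
      rw [hrS, htφ τ hτ]
      exact hneg' ht0
    have hWI : ∃ σ₀ ∈ absInertia (vq.adicCompletion ℚ), W σ₀ = 1 := by
      refine ⟨σ₀, hσ₀I, ?_⟩
      simp only [hW]
      rcases h01 (w₂ (r σ₀)) with h0 | h1
      · exfalso
        have h2 : (r σ₀) • α₁ = α₁ := (hw₁ _).mp h0
        have h3 : ι ((r σ₀) • α₁) = ι α₁ := by rw [h2]
        rw [happly, hσ₀] at h3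
        exact hneg' ((map_ne_zero ι).mpr hα₁0) h3
      · exact h1
    have hodd : Odd (ringChar 𝓀[vq.adicCompletion ℚ]) := by
      rw [ringChar_residueField_adicCompletion_rat q vq hvq]
      exact hq.odd_of_ne_two (by omega)
    exact localField_cup_not_split (vq.adicCompletion ℚ) hodd X W Bv hXadd hWadd hXI hXφ hWI
      (hw₂_lc.comp_continuous r.continuous) hBv_lc hBvid
  -- Step 10: Fermat: `|A| = x² + y²`
  obtain ⟨x, y, hxy⟩ := (Nat.eq_sq_add_sq_iff (n := n)).mpr fun q hq hq3 =>
    heven q (Nat.prime_of_mem_primeFactors hq) hq3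
  -- Step 11: `θ = x + y i₀`, `ρ = √θ`, `sb = ρ c(ρ)` with `sb² = |A|`; the characters `χθ`, `χn`
  set θ : AlgebraicClosure ℚ := (x : AlgebraicClosure ℚ) + (y : AlgebraicClosure ℚ) * i₀ with hθ
  have hθθ' : θ * ((x : AlgebraicClosure ℚ) - (y : AlgebraicClosure ℚ) * i₀) = (n : AlgebraicClosure ℚ) := by
    rw [hxy]
    push_cast
    calc ((x : AlgebraicClosure ℚ) + y * i₀) * (x - y * i₀) = (x : AlgebraicClosure ℚ) ^ 2 - y ^ 2 * i₀ ^ 2 := by ring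
      _ = _ := by rw [hi₀]; ring
  have hn0' : (n : AlgebraicClosure ℚ) ≠ 0 := Nat.cast_ne_zero.mpr hn0
  have hθ0 : θ ≠ 0 := fun h => hn0' (by rw [← hθθ', h, zero_mul])
  have hfixN : ∀ (σ : absoluteGaloisGroup ℚ) (t : ℕ), σ • (t : AlgebraicClosure ℚ) = t := fun σ t => by
    rw [absoluteGaloisGroup.smul_def, map_natCast]
  have hθS : ∀ h ∈ S, h • θ = θ := fun h hh => by
    rw [hθ, smul_add, smul_mul', hfixN, hfixN, (hSmem h).mp hh]
  have hcθ : c • θ = (x : AlgebraicClosure ℚ) - (y : AlgebraicClosure ℚ) * i₀ := by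
    rw [hθ, smul_add, smul_mul', hfixN, hfixN, hci₀, mul_neg, sub_eq_add_neg]
  obtain ⟨ρ, hρ⟩ := IsAlgClosed.exists_pow_nat_eq θ two_pos
  have hρ0 : ρ ≠ 0 := fun h => hθ0 (by rw [← hρ, h, zero_pow two_ne_zero])
  set sb : AlgebraicClosure ℚ := ρ * c • ρ with hsb
  have hsb2 : sb ^ 2 = (n : AlgebraicClosure ℚ) := by
    rw [hsb, mul_pow, ← smul_pow', hρ, hcθ, hθθ']
  have hsb0 : sb ≠ 0 := fun h => hn0' (by rw [← hsb2, h, zero_pow two_ne_zero])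
  have hρS : ∀ h ∈ S, h • ρ = ρ ∨ h • ρ = -ρ := fun h hh =>
    sq_eq_sq_iff_eq_or_eq_neg.mp (by rw [← smul_pow', hρ, hθS h hh])
  have hsbpm : ∀ σ : absoluteGaloisGroup ℚ, σ • sb = sb ∨ σ • sb = -sb := fun σ =>
    sq_eq_sq_iff_eq_or_eq_neg.mp (by rw [← smul_pow', hsb2, hfixN])
  set χθ : absoluteGaloisGroup ℚ → ZMod 2 := fun σ => if σ • ρ = ρ then 0 else 1 with hχθ
  set χn : absoluteGaloisGroup ℚ → ZMod 2 := fun σ => if σ • sb = sb then 0 else 1 with hχn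
  have hθS_add : ∀ h ∈ S, ∀ k ∈ S, χθ (h * k) = χθ h + χθ k := fun h hh k hk =>
    sqrt_indicator_mul hρ0 (hρS h hh) (hρS k hk)
  have hn_add : ∀ σ τ, χn (σ * τ) = χn σ + χn τ := fun σ τ =>
    sqrt_indicator_mul hsb0 (hsbpm σ) (hsbpm τ)
  have hcρ0 : c • ρ ≠ 0 := fun h => hρ0 (by
    have := congrArg (c • ·) h
    simpa only [smul_zero, ← mul_smul, hcc, one_smul] using this)
  have hn3 : ∀ k ∈ S, χn k = χθ k + χθ (c * k * c) := fun k hk => by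
    have hkc : k • (c • ρ) = c • ((c * k * c) • ρ) := by
      rw [← mul_smul, ← mul_smul, ← mul_assoc, ← mul_assoc, hcc, one_mul]
    have hkcpm : k • (c • ρ) = c • ρ ∨ k • (c • ρ) = -(c • ρ) := by
      rw [hkc]
      rcases hρS _ (hnorm k hk) with h | h <;> rw [h]
      · exact Or.inl rfl
      · exact Or.inr (smul_neg _ _)
    have h1 : χn k = χθ k + (if k • (c • ρ) = c • ρ then 0 else 1) := by
      simp only [hχn, hχθ, hsb]
      exact sqrt_indicator_smul_mul hρ0 hcρ0 (hρS k hk) hkcpm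
    rw [h1]
    congr 1
    simp only [hχθ]
    rw [hkc, smul_left_cancel_iff]
  have hn4 : χn c = 0 := by
    simp only [hχn]
    rw [if_pos]
    show c • (ρ * c • ρ) = ρ * c • ρ
    rw [smul_mul', ← mul_smul, hcc, one_smul, mul_comm]
  -- the explicit splitting `χ_S ∪ χn = ∂γ`
  set γ : absoluteGaloisGroup ℚ → ZMod 2 := fun σ => χθ (if σ ∈ S then σ else σ * c) with hγ
  have hN : ∀ σ τ, (if σ ∈ S then (0 : ZMod 2) else 1) * χn τ = γ σ + γ τ + γ (σ * τ) :=
    indexTwo_cup_eq_coboundary_of_norm S c hcc hSc hnorm χθ χn hθS_add hn_add hn3 hn4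
  -- local constancy of `γ`
  have hsmul_lc : IsLocallyConstant fun σ : absoluteGaloisGroup ℚ => σ • ρ := by
    have h := (isLocallyConstant_smul_units ℚ (Units.mk0 ρ hρ0)).comp
      fun u : (AlgebraicClosure ℚ)ˣ => (u : AlgebraicClosure ℚ)
    have heq : ((fun u : (AlgebraicClosure ℚ)ˣ => (u : AlgebraicClosure ℚ)) ∘
        fun σ : absoluteGaloisGroup ℚ => σ • Units.mk0 ρ hρ0) = fun σ => σ • ρ := by
      funext σ; rfl
    rw [heq] at h
    exact h
  have hχθ_lc : IsLocallyConstant χθ := hsmul_lc.comp fun t => if t = ρ then (0 : ZMod 2) else 1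
  have hγ_lc : IsLocallyConstant γ := by
    have heq : γ = fun σ => if σ ∈ S then χθ σ else χθ (σ * c) := by
      funext σ
      simp only [hγ]
      split_ifs <;> rfl
    rw [heq]
    exact isLocallyConstant_ite_mem hSclopen hχθ_lc (hχθ_lc.comp_continuous (continuous_mul_const c))
  -- the indicator `χ_S` is locally constant
  have hχS_lc : IsLocallyConstant fun σ : absoluteGaloisGroup ℚ => if σ ∈ S then (0 : ZMod 2) else 1 :=
    isLocallyConstant_ite_mem hSclopen (IsLocallyConstant.const 0) (IsLocallyConstant.const 1)
  -- Step 12: the sign of `A`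
  have hsign : A.sign = 1 ∨ A.sign = -1 := by
    rcases lt_or_gt_of_ne hA0 with h | h
    · exact Or.inr (Int.sign_eq_neg_one_of_neg h)
    · exact Or.inl (Int.sign_eq_one_of_pos h)
  rcases hsign with hpos | hnegA
  · -- `A = |A|`: `α₁ = ± sb`, so `w₂ = χn` and `z₂ = ∂(γ + δ₂)`
    have hAn : A = n := by rw [← Int.sign_mul_natAbs A, hpos, one_mul, hn]
    have hα₁sb : α₁ = sb ∨ α₁ = -sb := sq_eq_sq_iff_eq_or_eq_neg.mp (by
      rw [hα₁sq, hsb2, hAn]; push_cast; rfl)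
    have hkey : ∀ σ : absoluteGaloisGroup ℚ, σ • α₁ = α₁ ↔ σ • sb = sb := fun σ => by
      rcases hα₁sb with h | h <;> rw [h]
      rw [smul_neg, neg_inj]
    have hwn : ∀ σ, w₂ σ = χn σ := fun σ => by
      simp only [hχn]
      rcases h01 (w₂ σ) with h0 | h1
      · rw [h0, if_pos ((hkey σ).mp ((hw₁ σ).mp h0))]
      · rw [h1, if_neg]
        intro h
        have := (hw₁ σ).mpr ((hkey σ).mpr h)
        rw [this] at h1
        exact zero_ne_one h1
    have hz₂dec : ∀ σ τ, z₂ σ τ = (γ σ + δ₂ σ) + (γ τ + δ₂ τ) + (γ (σ * τ) + δ₂ (σ * τ)) :=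
      fun σ τ => by
        have hcup : (if σ ∈ S then (0 : ZMod 2) else w₂ τ) = (if σ ∈ S then (0 : ZMod 2) else 1) * χn τ := by
          split_ifs <;> simp [hwn]
        rw [hdec σ τ, hcup, hN σ τ]
        abel
    refine ⟨fun σ => e (γ σ + δ₂ σ), (hγ_lc.comp₂ hδ₂_lc fun a b => a + b).comp e, fun σ τ => ?_⟩
    have hzστ : z σ τ = e (z₂ σ τ) := (heψ _ (hz_2 σ τ)).symm
    have h2e : ∀ k, e k + e k = 0 := fun k => by rw [← two_nsmul, he2]
    rw [hzστ, hz₂dec, map_add, map_add]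
    calc e (γ σ + δ₂ σ) + e (γ τ + δ₂ τ) + e (γ (σ * τ) + δ₂ (σ * τ)) + e (γ (σ * τ) + δ₂ (σ * τ))
        = e (γ σ + δ₂ σ) + e (γ τ + δ₂ τ) +
            (e (γ (σ * τ) + δ₂ (σ * τ)) + e (γ (σ * τ) + δ₂ (σ * τ))) := by abel
      _ = e (γ σ + δ₂ σ) + e (γ τ + δ₂ τ) := by rw [h2e, add_zero]
  · -- `A = -|A|`: `α₁ = ± i₀ sb`, so `w₂ = χ_S + χn`, and `χ_S ∪ χ_S` would split at `2`
    exfalso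
    have hAn : A = -n := by rw [← Int.sign_mul_natAbs A, hnegA, hn]; ring
    have hα₁isb : α₁ = i₀ * sb ∨ α₁ = -(i₀ * sb) := sq_eq_sq_iff_eq_or_eq_neg.mp (by
      rw [hα₁sq, mul_pow, hi₀, hsb2, hAn]; push_cast; ring)
    have hisb0 : i₀ * sb ≠ 0 := mul_ne_zero hi₀0 hsb0
    have hkey : ∀ σ : absoluteGaloisGroup ℚ, σ • α₁ = α₁ ↔ σ • (i₀ * sb) = i₀ * sb := fun σ => by
      rcases hα₁isb with h | h <;> rw [h]
      rw [smul_neg, neg_inj]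
    have hwn : ∀ σ, w₂ σ = (if σ ∈ S then (0 : ZMod 2) else 1) + χn σ := fun σ => by
      have hind := sqrt_indicator_smul_mul hi₀0 hsb0 (hpm σ) (hsbpm σ)
      have hw' : w₂ σ = (if σ • (i₀ * sb) = i₀ * sb then (0 : ZMod 2) else 1) := by
        rcases h01 (w₂ σ) with h0 | h1
        · rw [h0, if_pos ((hkey σ).mp ((hw₁ σ).mp h0))]
        · rw [h1, if_neg]
          intro h
          have := (hw₁ σ).mpr ((hkey σ).mpr h)
          rw [this] at h1
          exact zero_ne_one h1
      rw [hw', hind]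
      simp only [hχn]
      congr 1
      by_cases hσ : σ ∈ S
      · rw [if_pos hσ, if_pos ((hSmem σ).mp hσ)]
      · rw [if_neg hσ, if_neg (fun h => hσ ((hSmem σ).mpr h))]
    -- the place above `2`
    set v2 : HeightOneSpectrum (𝓞 ℚ) := (primesEquiv (R := 𝓞 ℚ)).symm ⟨2, Nat.prime_two⟩ with hv2_def
    have hv2 : (primesEquiv v2 : ℕ) = 2 := by rw [hv2_def, Equiv.apply_symm_apply]
    set r2 := absGaloisRestrict ℚ (v2.adicCompletion ℚ) with hr2
    set ι2 := absClosureEmbedding ℚ (v2.adicCompletion ℚ) with hι2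
    have happly2 : ∀ (x : absoluteGaloisGroup (v2.adicCompletion ℚ)) (m : AlgebraicClosure ℚ),
        ι2 ((r2 x) • m) = x • ι2 m := fun x m => absGaloisRestrict_apply_smul ℚ _ x m
    obtain ⟨B2, hB2_lc, hB2id⟩ := hloc₂ v2
    set X : absoluteGaloisGroup (v2.adicCompletion ℚ) → ZMod 2 := fun x => if r2 x ∈ S then 0 else 1
      with hX
    have hX_lc : IsLocallyConstant X := hχS_lc.comp_continuous r2.continuous
    have hXadd : ∀ x y, X (x * y) = X x + X y := fun x y => by
      simp only [hX, map_mul]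
      exact indexTwo_indicator_mul S c hcc hSc hnorm _ _
    set B' : absoluteGaloisGroup (v2.adicCompletion ℚ) → ZMod 2 := fun x => B2 x + γ (r2 x) with hB'
    have hB'_lc : IsLocallyConstant B' :=
      hB2_lc.comp₂ (hγ_lc.comp_continuous r2.continuous) fun a b => a + b
    have hB'id : ∀ x y, B' (x * y) = B' x + B' y + X x * X y := fun x y => by
      simp only [hB', hX]
      rw [map_mul, hB2id x y, hwn (r2 y), mul_add, hN (r2 x) (r2 y)]
      calc B2 x + B2 y + ((if r2 x ∈ S then (0 : ZMod 2) else 1) * (if r2 y ∈ S then (0 : ZMod 2) else 1) +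
            (γ (r2 x) + γ (r2 y) + γ (r2 x * r2 y))) + γ (r2 x * r2 y)
          = B2 x + γ (r2 x) + (B2 y + γ (r2 y)) +
              (if r2 x ∈ S then (0 : ZMod 2) else 1) * (if r2 y ∈ S then (0 : ZMod 2) else 1) +
              (γ (r2 x * r2 y) + γ (r2 x * r2 y)) := by abel
        _ = _ := by rw [hA, add_zero]
    -- `μ = q₄ ∘ X + e ∘ B'` is a character with `2 μ = (1/2) [X ≠ 0]`
    set q₄ : ZMod 2 → AddCircle (1 : ℚ) := fun t =>
      if t = 0 then 0 else (((1 : ℚ) / 4 : ℚ) : AddCircle (1 : ℚ)) with hq₄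
    set μ : absoluteGaloisGroup (v2.adicCompletion ℚ) → AddCircle (1 : ℚ) :=
      fun x => q₄ (X x) + e (B' x) with hμ
    have hμ_lc : IsLocallyConstant μ := (hX_lc.comp q₄).comp₂ (hB'_lc.comp e) fun a b => a + b
    have hquarter : (((1 : ℚ) / 4 : ℚ) : AddCircle (1 : ℚ)) + (((1 : ℚ) / 4 : ℚ) : AddCircle (1 : ℚ)) =
        (((1 : ℚ) / 2 : ℚ) : AddCircle (1 : ℚ)) := by
      rw [← AddCircle.coe_add]; norm_num
    have h10 : (1 : ZMod 2) ≠ 0 := one_ne_zero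
    have h11 : (1 : ZMod 2) + 1 = 0 := hA 1
    have hμ_add : ∀ x y, μ (x * y) = μ x + μ y := fun x y => by
      simp only [hμ]
      rw [hB'id, hXadd, map_add, map_add]
      rcases h01 (X x) with hx0 | hx1 <;> rcases h01 (X y) with hy0 | hy1
      · rw [hx0, hy0]; simp only [hq₄, add_zero, if_true, mul_zero, map_zero]; abel
      · rw [hx0, hy1]; simp only [hq₄, zero_add, if_true, h10, if_false, zero_mul, map_zero, add_zero]; abel
      · rw [hx1, hy0]; simp only [hq₄, add_zero, if_true, h10, if_false, mul_zero, map_zero]; abel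
      · rw [hx1, hy1]; simp only [hq₄, h11, if_true, h10, if_false, mul_one, he1]
        rw [← hquarter]; abel
    have h2μ : ∀ x, 2 • μ x =
        (if X x = 0 then (0 : AddCircle (1 : ℚ)) else (((1 : ℚ) / 2 : ℚ) : AddCircle (1 : ℚ))) :=
      fun x => by
        simp only [hμ]
        rw [nsmul_add, he2, add_zero]
        rcases h01 (X x) with h0 | h1
        · rw [h0]; simp only [hq₄, if_true, smul_zero]
        · rw [h1]; simp only [hq₄, h10, if_false]; rw [two_nsmul, hquarter]
    -- `[X ≠ 0] = 1/2` wherever `χ_4 = -1`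
    haveI : NeZero ((4 : ℕ) : v2.adicCompletion ℚ) := ⟨by
      haveI : CharZero (v2.adicCompletion ℚ) := charZero_adicCompletion (K := ℚ) v2
      exact_mod_cast (show (4 : ℕ) ≠ 0 by norm_num)⟩
    have ht2 : (ι2 i₀) ^ 2 = -1 := by rw [← map_pow, hi₀, map_neg, map_one]
    have ht4 : (ι2 i₀) ^ 4 = 1 := by
      rw [show (4 : ℕ) = 2 * 2 from rfl, pow_mul, ht2]; norm_num
    have ht0 : ι2 i₀ ≠ 0 := fun h => by rw [h] at ht2; norm_num at ht2
    have hlam : ∀ σ, modNCyclotomicCharacter (v2.adicCompletion ℚ) 4 σ = -1 →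
        (if X σ = 0 then (0 : AddCircle (1 : ℚ)) else (((1 : ℚ) / 2 : ℚ) : AddCircle (1 : ℚ))) =
          (((1 : ℚ) / 2 : ℚ) : AddCircle (1 : ℚ)) := fun σ hσ => by
      have hnotS : r2 σ ∉ S := fun h => by
        have h1 : (r2 σ) • i₀ = i₀ := (hSmem _).mp h
        have h2 : σ • ι2 i₀ = ι2 i₀ := by rw [← happly2, h1]
        have hspec := modNCyclotomicCharacter_spec (v2.adicCompletion ℚ) 4 σ (ι2 i₀) ht4
        rw [hσ] at hspec
        have hval : (((-1 : (ZMod 4)ˣ) : ZMod 4)).val = 3 := by decide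
        rw [hval, pow_succ, ht2, neg_one_mul, h2] at hspec
        haveI : CharZero (v2.adicCompletion ℚ) := charZero_adicCompletion (K := ℚ) v2
        apply ht0
        have h3 : ι2 i₀ + ι2 i₀ = 0 := by nth_rewrite 2 [hspec]; exact add_neg_cancel _
        rwa [← two_mul, mul_eq_zero, or_iff_right two_ne_zero] at h3
      have hXσ : X σ ≠ 0 := by
        simp only [hX]
        rw [if_neg hnotS]
        exact one_ne_zero
      rw [if_neg hXσ]
    exact adicCompletion_rat_not_two_divisible_of_modFour v2 hv2 μ hμ_lc hμ_add _ hlam h2μ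

/-- **`(H_2)(Γ_ℚ)`: `H²(G_ℚ, ℚ_2/ℤ_2) = 0` in cochain form, granted the Hasse principle for
`Br(ℚ(i))`** (Serre, Durham §6.5, `p = 2`): every locally constant `2`-torsion `2`-cocycle `g` on
`Γ_ℚ` with values in `ℚ/ℤ` is the coboundary of a locally constant cochain.  Proof: `z = g - ∂c`
(`rat_exists_character_levelOne_two`) is finite-locally trivial, hence splits
(`twoCocycle_addCircle_two_split_rat_of_locallyTrivial`), and so does `g = z + ∂c`.
[cite: SerreDurham1977, §6.5] [cite: Harari2020, Thm. 14.11] -/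
theorem twoCocycle_addCircle_two_split_rat_of_brauerHassePrinciple
    (hB : brauerHassePrinciple (CyclotomicField 4 ℚ))
    (g : absoluteGaloisGroup ℚ → absoluteGaloisGroup ℚ → AddCircle (1 : ℚ))
    (hg : IsLocallyConstant (Function.uncurry g))
    (hcoc : ∀ σ τ υ, g σ τ + g (σ * τ) υ = g τ υ + g σ (τ * υ)) (h2g : ∀ σ τ, 2 • g σ τ = 0) :
    ∃ b : absoluteGaloisGroup ℚ → AddCircle (1 : ℚ), IsLocallyConstant b ∧
      ∀ σ τ, g σ τ + b (σ * τ) = b σ + b τ := by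
  -- Serre's global character: `z = g - ∂c` is locally trivial at level one at every finite place
  obtain ⟨φ, c, -, hφ_add, hc_lc, hpc, hloc⟩ := rat_exists_character_levelOne_two g hg hcoc h2g
  set z : absoluteGaloisGroup ℚ → absoluteGaloisGroup ℚ → AddCircle (1 : ℚ) :=
    fun σ τ => g σ τ - (c σ + c τ - c (σ * τ)) with hz_def
  have hz_lc : IsLocallyConstant (Function.uncurry z) := by
    have h1 : IsLocallyConstant fun x : absoluteGaloisGroup ℚ × absoluteGaloisGroup ℚ => c x.1 :=
      hc_lc.comp_continuous continuous_fst
    have h2 : IsLocallyConstant fun x : absoluteGaloisGroup ℚ × absoluteGaloisGroup ℚ => c x.2 :=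
      hc_lc.comp_continuous continuous_snd
    have h3 : IsLocallyConstant fun x : absoluteGaloisGroup ℚ × absoluteGaloisGroup ℚ =>
        c (x.1 * x.2) := hc_lc.comp_continuous (continuous_fst.mul continuous_snd)
    rw [show Function.uncurry z = fun x : absoluteGaloisGroup ℚ × absoluteGaloisGroup ℚ =>
      Function.uncurry g x - (c x.1 + c x.2 - c (x.1 * x.2)) from rfl]
    exact hg.comp₂ ((h1.comp₂ h2 fun a b => a + b).comp₂ h3 fun a b => a - b) fun a b => a - b
  have hz_coc : ∀ σ τ υ, z σ τ + z (σ * τ) υ = z τ υ + z σ (τ * υ) := fun σ τ υ => by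
    simp only [hz_def, mul_assoc]
    have h := hcoc σ τ υ
    rw [← sub_eq_zero] at h ⊢
    rw [← h]
    abel
  have hz_2 : ∀ σ τ, 2 • z σ τ = 0 := fun σ τ => by
    simp only [hz_def, nsmul_sub, nsmul_add, h2g, hpc, hφ_add, sub_self]
  have hz_loc : ∀ v : HeightOneSpectrum (𝓞 ℚ),
      ∃ β : absoluteGaloisGroup (v.adicCompletion ℚ) → AddCircle (1 : ℚ), IsLocallyConstant β ∧
        (∀ σ τ, z (absGaloisRestrict ℚ (v.adicCompletion ℚ) σ)
            (absGaloisRestrict ℚ (v.adicCompletion ℚ) τ) + β (σ * τ) = β σ + β τ) ∧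
        ∀ σ, 2 • β σ = 0 := fun v => by
    obtain ⟨β, hβ_lc, hβ, hβ2⟩ := hloc v
    refine ⟨β, hβ_lc, fun σ τ => ?_, hβ2⟩
    have h := hβ σ τ
    rw [map_mul] at h
    exact h
  obtain ⟨b, hb_lc, hb⟩ :=
    twoCocycle_addCircle_two_split_rat_of_locallyTrivial hB z hz_lc hz_coc hz_2 hz_loc
  -- hence so does `g = z + ∂c`
  refine ⟨fun σ => b σ + c σ, hb_lc.comp₂ hc_lc fun x y => x + y, fun σ τ => ?_⟩
  have h := hb σ τ
  show g σ τ + (b (σ * τ) + c (σ * τ)) = (b σ + c σ) + (b τ + c τ)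
  have e1 : g σ τ + (b (σ * τ) + c (σ * τ)) = (z σ τ + b (σ * τ)) + (c σ + c τ) := by
    simp only [hz_def]
    abel
  rw [e1, h]
  abel

/-- **`Tate_projectiveLifting` from the Hasse principle for the Brauer groups of `ℚ(μ_p)`
(`p` odd) and of `ℚ(i)`.**  The named fact `Tate_projectiveLifting` (Serre, Durham 1977, §6.1,
Cor. to Thm. 4: every projective representation of `G_ℚ` with open kernel over an algebraically
closed field lifts to a linear one; proof in §6.5 via `H²(G_ℚ, ℚ/ℤ) = 0`) follows from the named
fact `Literature.NumberTheory.GaloisCohomology.brauerHassePrinciple` (Brauer–Hasse–Noether, Harari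
Thm. 14.11 — Serre's global input in §6.5 (c): "an element of `Br_p(K)` is described by its local
components") for the cyclotomic fields `ℚ(μ_p)`, `p` an odd prime, and `ℚ(i) = ℚ(μ_4)`.
[cite: SerreDurham1977, §6.1 Cor. to Thm. 4, §6.5] [cite: Harari2020, Thm. 14.11] -/
theorem Tate_projectiveLifting_of_brauerHassePrinciple'
    (hB : ∀ p : ℕ, p.Prime → p ≠ 2 → brauerHassePrinciple (CyclotomicField p ℚ))
    (hB2 : brauerHassePrinciple (CyclotomicField 4 ℚ)) : Tate_projectiveLifting :=
  Tate_projectiveLifting_of_brauerHassePrinciple hB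
    (twoCocycle_addCircle_two_split_rat_of_brauerHassePrinciple hB2)

end Main

end Literature.NumberTheory.GaloisRepresentations

end
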